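import Summits.QuantumFields.BalabanUV.Beta.D1BFx.PeriodicArrayBiSuperposition
import Summits.QuantumFields.BalabanUV.Beta.D1BFx.PeriodicArrayWrapUniform
import Summits.QuantumFields.BalabanUV.Beta.D1BFx.PeriodicArraySuperpositionTorus

/-!
# `BalabanUV.Beta.D1BFx.PeriodicArrayBiSuperpositionTorus` — road «BF-x» for binder row D1, slot (K), chain step (I) «(A1)-PACKED», brick (B4e)
# «PACKED-DICT₂-HAT» (`A1-PACKED-SPEC.md` v0.3.1 §8 + v0.4 §9; FINDINGS F-g16-1 «WRAP», F-g17-1 «INTER-BOND» = gan24-leaf-05 g50's R-gan24leaf05-g50-1):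
# **THE TORUS-MATRIX FORM OF (B4d)** — on every coarse torus, the response-packed sum of the torus PAIR tables is the periodised sorted array of
# the one-periodised `ℤ^D` double superposition:
# `Σ_{k,l} r k · r′ l • (Σ'_t arr s (S₂ κ′_k ŵ_k κ′_l (ŵ_l + s·t)))ˆ = (arr s 𝒲^{(s)})ˆ`, `ˆ := blocksHat p ∘ sortK n`, `s = n·p`,
# `𝒲^{(s)} := Σ_{κ′ λ′} wsum (w κ′) (u ↦ Σ'_{u″} (Σ'_m w′ λ′ (u″ + s·m)) · S₂ κ′ u λ′ u″)`.

HONEST DEPENDENCY (cell records, verbatim): «continuum YM on T⁴ ⇐ BetaPertH ∧ nine spine estimates (0/9 proved); BetaPertH ⇐ (D1) ∧ (D4) ∧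
CAP+tail; G-an2-4 gates asym, D1 and NE2/3/4.»  HONEST FRAMING (cell contract, verbatim): «discharging `BetaPertH` makes Bałaban's UV stability
UNCONDITIONAL — a real constructive-QFT result; it is NOT the continuum limit and NOT the Clay problem.»  THIS MODULE DISCHARGES NOTHING of (K),
of D1 or of the wall: [folklore] exponential `ℤ^D` bookkeeping (`PeriodicArrays.decays_arr`, image sums) + linearity of `blocksHat p ∘ sortK n`
(`PeriodicArraySuperpositionTorus.blocksHat_sortK_finset_sum`) + (B4d) `PeriodicArrayBiSuperposition.packed₂_eq_arr_periodised` BY NAME + finite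
re-indexing along `SortedReblocking.torusBlockEquiv`.  No definition, no `def … : Prop`, nothing cited, 0 sorry.  0 root-level binders of row D1
discharged; (K) NOT closed; NOT D1, NOT `BetaPertH`, NOT continuum, NOT Clay.

ABSOLUTE RULE (cell charter, verbatim): «No internally-minted statement may enter as a cited fact. Every hypothesis is either kernel-proved in this
package or a verbatim quotation of a PUBLISHED theorem with page reference. The manuscript(s) under audit are NOT citable for their own disputed
steps — they are the thing under adjudication; programme-internal (2001/route/tribunal) claims are never citable.»

WHY (owner d1-p2 gen 17).  (B3) «A1-PACKED-TORUS» instantiates `KCombineCovColourTorus.identity_array_currency_cov_What0_stripped` with RESPONSE-PACKED jets;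
its second-order dictionary letter `hJM″` wants the packed second jet `𝕄ₛₜ := Σ_{k,l} rₛ k · rₜ l • 𝕄₂ k l` (torus responses × torus pair tables) AS a
periodised sorted array `(arr s 𝒲)ˆ` of a `ℤ^D` table.  (B4d) identified the `ℤ^D` table ENTRYWISE (the one-periodised double superposition, F-g16-1);
THIS FILE lifts the identity to the torus matrices.  THE HYPOTHESIS SHAPE (F-g17-1 «INTER-BOND» ∕ R-gan24leaf05-g50-1): the torus pair table w.r.t. a PAIR
of torus bonds is the `t`-SUMMED table `T_{u,u′} := Σ'_t arr s (K₂ u (u′ + s·t))` (one representative `u`, ALL relative images of `u′`); under the (B4d)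
shape `BiLoc (K₂ u u′) u u′ Cₖ δ` ALONE `T_{u,u′}` is periodic in `y` SEPARATELY and its coarse periodisation DIVERGES (the torus table is undefined as a
`blocksHat`); under the road's bi-stencil shape — the BODY of an2's `BalabanCompositeJets.LocStencil₂`, `BiLoc (K₂ u u′) u u (Cₖ·e^{−δ|u′−u|₁}) δ`
(bi-localised at the FIRST bond, constant decaying in the bond separation) — `T_{u,u′}` DECAYS at rate `δ∕2` with an `s`-FREE constant (§1), so its image
rows are summable and `blocksHat_sortK_finset_sum` applies.  The `s`-uniform `BiLoc` of `𝒲^{(s)}` itself is gan24-leaf-05's «WRAP-UNIFORM»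
(`PeriodicArrayWrapUniform.biLoc_wsum_images`, p315851 ✓ — imported for `biLoc_pair_of_sep`); §3 takes it as the displayed socket `hWloc` (one line for (B3)
to discharge by that name).

CONTENT (all [folklore]; `D = d+1`, fibre `Fib d`).
* §1 THE TORUS PAIR TABLE DECAYS (generic `D`, `F`; the body ⇒ the (B4d) shape is gan24-leaf-05's `PeriodicArrayWrapUniform.biLoc_pair_of_sep`, imported): `decays_arr_pair`
  (`Decays (arr s (K₂ u (u′+s·t))) (Cₖ·e^{−δ|u′+s·t−u|₁}·Zl(δ∕2)) (δ∕2)`), `summable_pair_arr`, **`decays_pairTable`** (`Decays T_{u,u′} (Cₖ·Zl(δ∕2)·Zl D δ) (δ∕2)`),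
  `summable_pairTable_images`.
* §2 **`blocksHat_sortK_arr_packed₂`** (generic weights `w`, `w′`, pair family `K₂`, window-indexed):
  `(arr s 𝒲^{(s)})ˆ = Σ_{zz zz′ : Site (n·p)} (Σ'_m w (ẑ + s·m))·(Σ'_{m′} w′ (ẑ′ + s·m′)) • (T_{ẑ,ẑ′})ˆ`, `ẑ = windowMap (n·p) zz`.
* §3 **`blocksHat_sortK_arr_packed₂_dir`** (directional families `w κ′`, `w′ λ′`, `S₂ κ′ u λ′ u′`, indexed by the torus KKT index `I d n p` as in (B4c)
  `blocksHat_sortK_arr_vertexOfK`; displayed socket `hWloc` = «WRAP-UNIFORM» per slice).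
Unit `b2b-balaban-beta-d1-p2` (road owner, gen 17), 2026-08-22.
-/

noncomputable section

namespace Summit.QuantumFields.BalabanUV.Beta.D1BFx.PeriodicArrayBiSuperpositionTorus

open Matrix
open scoped BigOperators
open Literature.Probability.LatticeModels (TorusSite)
open Literature.MathematicalPhysics.QuantumFieldTheory.Balaban1983to89
open Literature.MathematicalPhysics.QuantumFieldTheory.Balaban1983to89.Beta
open B12Sec2to5 (l1 l1_nonneg)
open ExpKernelCalculus (MKer BiLoc Decays shiftK Zl Zl_pos Zl_nonneg l1_sub_triangle l1_sub_symm)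
open OneStepResolventKernel (Fib wsum)
open Summit.QuantumFields.BalabanUV.Beta.D1BFx.SortedKernels (blocksHat)
open Summit.QuantumFields.BalabanUV.Beta.D1BFx.SortedReblocking (torusBlockEquiv summable_abs_row)
open Summit.QuantumFields.BalabanUV.Beta.D1BFx.SortedPack (sortK)
open Summit.QuantumFields.BalabanUV.Beta.D1BFx.PeriodicArrays (arr arr_apply tsum_exp_imageShift_le decays_arr)
open Summit.QuantumFields.BalabanUV.Beta.D1BFx.PeriodicArraySuperposition (arr_finset_sum_apply)
open Summit.QuantumFields.BalabanUV.Beta.D1BFx.PeriodicArrayBiSuperposition (packed₂_eq_arr_periodised)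
open Summit.QuantumFields.BalabanUV.Beta.D1BFx.PeriodicArrayWrapUniform (biLoc_pair_of_sep)
open Summit.QuantumFields.BalabanUV.Beta.D1BFx.PeriodicArraySuperpositionTorus (blocksHat_sortK_finset_sum summable_images_arr)

/-! ## §1 The `t`-summed torus pair table decays (the `LocStencil₂` body) -/

section PairTable

variable {D : ℕ} {F : Type*} {K₂ : ExpKernelCalculus.Site D → ExpKernelCalculus.Site D → MKer D F} {Ck δ : ℝ}

variable {s : ℕ} [NeZero s]

/-- [folklore] **EACH IMAGE TERM DECAYS**: under the `LocStencil₂` body, `Decays (arr s (K₂ u (u′ + s·t))) (Cₖ·e^{−δ|u′+s·t−u|₁}·Zl(δ∕2)) (δ∕2)`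
(`PeriodicArrays.decays_arr` at the localisation pair `(u, u)`: no centre-separation loss). -/
theorem decays_arr_pair (hK : ∀ u u', BiLoc (K₂ u u') u u (Ck * Real.exp (-δ * l1 (u' - u))) δ) (hδ : 0 < δ)
    (u u' t : ExpKernelCalculus.Site D) :
    Decays (arr s (K₂ u (imageShift s u' t))) (Ck * Real.exp (-δ * l1 (imageShift s u' t - u)) * Zl D (δ / 2)) (δ / 2) := by
  intro x y a b
  have h := decays_arr (hK u (imageShift s u' t)) hδ s x y a b
  have h0 : l1 (u - u) = 0 := by simp [B12Sec2to5.l1]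
  rw [h0, mul_zero, Real.exp_zero, mul_one] at h
  exact h

/-- [folklore] The `t`-family of image arrays is summable at every entry. -/
theorem summable_pair_arr (hK : ∀ u u', BiLoc (K₂ u u') u u (Ck * Real.exp (-δ * l1 (u' - u))) δ) (hδ : 0 < δ)
    (u u' x y : ExpKernelCalculus.Site D) (a b : F) :
    Summable fun t : ExpKernelCalculus.Site D => arr s (K₂ u (imageShift s u' t)) x y a b := by
  refine Summable.of_norm_bounded
    (((tsum_exp_imageShift_le hδ s u' u).1).mul_left (Ck * Zl D (δ / 2) * Real.exp (-(δ / 2) * l1 (x - y)))) fun t => ?_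
  rw [Real.norm_eq_abs]
  calc |arr s (K₂ u (imageShift s u' t)) x y a b|
      ≤ Ck * Real.exp (-δ * l1 (imageShift s u' t - u)) * Zl D (δ / 2) * Real.exp (-(δ / 2) * l1 (x - y)) :=
        decays_arr_pair hK hδ u u' t x y a b
    _ = _ := by ring

/-- [folklore] **THE `t`-SUMMED TORUS PAIR TABLE DECAYS, UNIFORMLY IN THE PERIOD** (F-g17-1): under the `LocStencil₂` body (`Cₖ ≥ 0`, `δ > 0`), for every
`s ≥ 1` and every pair of bonds `(u, u′)`,
`Decays (fun x y a b => Σ'_t arr s (K₂ u (u′ + s·t)) x y a b) (Cₖ·Zl(δ∕2)·Zl D δ) (δ∕2)`. -/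
theorem decays_pairTable (hK : ∀ u u', BiLoc (K₂ u u') u u (Ck * Real.exp (-δ * l1 (u' - u))) δ) (hδ : 0 < δ) (hCk : 0 ≤ Ck)
    (u u' : ExpKernelCalculus.Site D) :
    Decays (fun x y a b => ∑' t : ExpKernelCalculus.Site D, arr s (K₂ u (imageShift s u' t)) x y a b)
      (Ck * Zl D (δ / 2) * Zl D δ) (δ / 2) := by
  intro x y a b
  have hmaj := ((tsum_exp_imageShift_le hδ s u' u).1).mul_left (Ck * Zl D (δ / 2) * Real.exp (-(δ / 2) * l1 (x - y)))
  have hb : ∀ t : ExpKernelCalculus.Site D, ‖arr s (K₂ u (imageShift s u' t)) x y a b‖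
      ≤ Ck * Zl D (δ / 2) * Real.exp (-(δ / 2) * l1 (x - y)) * Real.exp (-δ * l1 (imageShift s u' t - u)) := fun t => by
    rw [Real.norm_eq_abs]
    calc |arr s (K₂ u (imageShift s u' t)) x y a b|
        ≤ Ck * Real.exp (-δ * l1 (imageShift s u' t - u)) * Zl D (δ / 2) * Real.exp (-(δ / 2) * l1 (x - y)) :=
          decays_arr_pair hK hδ u u' t x y a b
      _ = _ := by ring
  have h := tsum_of_norm_bounded hmaj.hasSum hb
  rw [Real.norm_eq_abs] at h
  refine h.trans ?_
  rw [tsum_mul_left]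
  have hpos : 0 ≤ Ck * Zl D (δ / 2) * Real.exp (-(δ / 2) * l1 (x - y)) :=
    mul_nonneg (mul_nonneg hCk (Zl_nonneg (half_pos hδ))) (Real.exp_pos _).le
  calc Ck * Zl D (δ / 2) * Real.exp (-(δ / 2) * l1 (x - y)) * ∑' t : ExpKernelCalculus.Site D, Real.exp (-δ * l1 (imageShift s u' t - u))
      ≤ Ck * Zl D (δ / 2) * Real.exp (-(δ / 2) * l1 (x - y)) * Zl D δ :=
        mul_le_mul_of_nonneg_left (tsum_exp_imageShift_le hδ s u' u).2 hpos
    _ = _ := by ring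

/-- [folklore] … hence its IMAGE ROWS are summable, for any image period `σ ≥ 1` (the hypothesis of
`PeriodicArraySuperpositionTorus.blocksHat_sortK_finset_sum` at `σ = n·p = s`). -/
theorem summable_pairTable_images (hK : ∀ u u', BiLoc (K₂ u u') u u (Ck * Real.exp (-δ * l1 (u' - u))) δ) (hδ : 0 < δ) (hCk : 0 ≤ Ck)
    (u u' : ExpKernelCalculus.Site D) (σ : ℕ) [NeZero σ] (a b : F) (x w : ExpKernelCalculus.Site D) :
    Summable fun t' : ExpKernelCalculus.Site D =>
      (fun x y a b => ∑' t : ExpKernelCalculus.Site D, arr s (K₂ u (imageShift s u' t)) x y a b) x (imageShift σ w t') a b :=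
  summable_row_imageShift (K := fun x y => ∑' t : ExpKernelCalculus.Site D, arr s (K₂ u (imageShift s u' t)) x y a b)
    (fun x => (summable_abs_row (decays_pairTable hK hδ hCk u u') (half_pos hδ) x a b).of_abs) x w

end PairTable

/-! ## §2 The torus-matrix form of (B4d), generic weights -/

section Hat

variable {d : ℕ} {n p : ℕ} [NeZero n] [NeZero p]
variable {w w' : (Fin (d + 1) → ℤ) → ℝ} {K₂ : (Fin (d + 1) → ℤ) → (Fin (d + 1) → ℤ) → MKer (d + 1) (Fib d)} {C C' Ck δ : ℝ}
  {P P' : Fin (d + 1) → ℤ}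

/-- [folklore] **«PACKED-DICT₂-HAT», GENERIC FORM.**  For decaying weights `w` (from `P`), `w′` (from `P′`), a pair family `K₂` with the `LocStencil₂` body
(`BiLoc (K₂ u u′) u u (Cₖ·e^{−δ|u′−u|₁}) δ`), jointly covariant under PERIOD translates (`K₂ (u + s·m) (u′ + s·m) = shiftK (−s·m) (K₂ u u′)`, `s = n·p`):
`blocksHat p (sortK n (arr s 𝒲^{(s)})) = Σ_{zz zz′ : Site (n·p)} (Σ'_m w (ẑ + s·m))·(Σ'_{m′} w′ (ẑ′ + s·m′)) • blocksHat p (sortK n (fun x y a b => Σ'_t arr s (K₂ ẑ (ẑ′ + s·t)) x y a b))`,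
`𝒲^{(s)} := wsum w (u ↦ Σ'_{u″} (Σ'_m w′ (u″ + s·m)) · K₂ u u″)` (the one-periodised double superposition of F-g16-1), `ẑ := windowMap (n·p) zz`. -/
theorem blocksHat_sortK_arr_packed₂ (hw : ∀ u, |w u| ≤ C * Real.exp (-δ * l1 (u - P))) (hw' : ∀ u, |w' u| ≤ C' * Real.exp (-δ * l1 (u - P')))
    (hK : ∀ u u', BiLoc (K₂ u u') u u (Ck * Real.exp (-δ * l1 (u' - u))) δ)
    (hKcov : ∀ u u' m, K₂ (imageShift (n * p) u m) (imageShift (n * p) u' m) = shiftK (-(((n * p : ℕ) : ℤ) • m)) (K₂ u u'))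
    (hδ : 0 < δ) (hC : 0 ≤ C) (hC' : 0 ≤ C') (hCk : 0 ≤ Ck) :
    blocksHat p (sortK n (arr (n * p) (wsum w (fun u => fun x y a b =>
        ∑' u'' : Fin (d + 1) → ℤ, (∑' m : Fin (d + 1) → ℤ, w' (imageShift (n * p) u'' m)) * K₂ u u'' x y a b))))
      = ∑ zz : Beta.Site (d + 1) (n * p), ∑ zz' : Beta.Site (d + 1) (n * p),
          ((∑' m : Fin (d + 1) → ℤ, w (imageShift (n * p) (windowMap (d + 1) (n * p) zz) m))
              * (∑' m' : Fin (d + 1) → ℤ, w' (imageShift (n * p) (windowMap (d + 1) (n * p) zz') m')))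
            • blocksHat p (sortK n (fun x y a b => ∑' t : Fin (d + 1) → ℤ,
                arr (n * p) (K₂ (windowMap (d + 1) (n * p) zz) (imageShift (n * p) (windowMap (d + 1) (n * p) zz') t)) x y a b)) := by
  -- (B4d) entrywise, in product-indexed form
  have hB4d := packed₂_eq_arr_periodised (s := n * p) hw hw' (fun u u' => biLoc_pair_of_sep hK hδ.le u u') hKcov hδ hC hC'
  have hfun : arr (n * p) (wsum w (fun u => fun x y a b =>
        ∑' u'' : Fin (d + 1) → ℤ, (∑' m : Fin (d + 1) → ℤ, w' (imageShift (n * p) u'' m)) * K₂ u u'' x y a b))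
      = fun x y a b => ∑ i ∈ (Finset.univ : Finset (Beta.Site (d + 1) (n * p) × Beta.Site (d + 1) (n * p))),
          ((∑' m : Fin (d + 1) → ℤ, w (imageShift (n * p) (windowMap (d + 1) (n * p) i.1) m))
              * (∑' m' : Fin (d + 1) → ℤ, w' (imageShift (n * p) (windowMap (d + 1) (n * p) i.2) m')))
            * (fun x y a b => ∑' t : Fin (d + 1) → ℤ,
                arr (n * p) (K₂ (windowMap (d + 1) (n * p) i.1) (imageShift (n * p) (windowMap (d + 1) (n * p) i.2) t)) x y a b) x y a b := by
    funext x y a b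
    rw [← hB4d x y a b, Fintype.sum_prod_type]
    refine Finset.sum_congr rfl fun zz _ => Finset.sum_congr rfl fun zz' _ => ?_
    simp only
    ring
  rw [hfun, blocksHat_sortK_finset_sum Finset.univ _ _ (fun i _ a b x w' =>
    summable_pairTable_images (s := n * p) hK hδ hCk _ _ (n * p) a b x w'), Fintype.sum_prod_type]

end Hat

/-! ## §3 The directional, `I d n p`-indexed form for (B3) -/

section Directional

/-- [folklore] Double sums re-indexed along an equivalence in both variables. -/
theorem sum_sum_reindex {α β M : Type*} [Fintype α] [Fintype β] [AddCommMonoid M] (e : α ≃ β) (G : β → β → M) :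
    (∑ q, ∑ q', G q q') = ∑ k, ∑ l, G (e k) (e l) := by
  rw [← Fintype.sum_equiv e (fun k => ∑ l, G (e k) (e l)) (fun q => ∑ q', G q q')
    (fun k => Fintype.sum_equiv e _ _ (fun l => rfl))]

/-- [folklore] A finite double sum over a product type, split and re-associated: `Σ_{(a,b)} Σ_c Σ_{c′} f = Σ_{(a,c)} Σ_{(b,c′)} f`. -/
theorem sum_prod_sum_sum {α γ M : Type*} [Fintype α] [Fintype γ] [AddCommMonoid M] (f : α → γ → α → γ → M) :
    (∑ i : α × α, ∑ c : γ, ∑ c' : γ, f i.1 c i.2 c') = ∑ q : α × γ, ∑ q' : α × γ, f q.1 q.2 q'.1 q'.2 := by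
  simp only [Fintype.sum_prod_type]
  exact Finset.sum_congr rfl fun a _ => Finset.sum_comm

variable {d : ℕ} {n p : ℕ} [NeZero n] [NeZero p]
variable {w w' : Fin (d + 1) → (Fin (d + 1) → ℤ) → ℝ}
  {S₂ : Fin (d + 1) → (Fin (d + 1) → ℤ) → Fin (d + 1) → (Fin (d + 1) → ℤ) → MKer (d + 1) (Fib d)} {C C' Ck δ CW δW : ℝ}
  {P P' : Fin (d + 1) → (Fin (d + 1) → ℤ)} {PW QW : Fin (d + 1) → Fin (d + 1) → (Fin (d + 1) → ℤ)}

/-- [folklore] **«PACKED-DICT₂-HAT», DIRECTIONAL FORM** (the (B3) letter `hJM″` for response-packed data).  For direction-indexed decaying weights `w κ′`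
(from `P κ′`), `w′ λ′` (from `P′ λ′`), a fine bi-stencil family `S₂` with the `LocStencil₂` body (`∀ κ′ u λ′ u′, BiLoc (S₂ κ′ u λ′ u′) u u (Cₖ·e^{−δ|u′−u|₁}) δ` —
`BalabanCompositeJets.LocStencil₂ S₂ Cₖ δ` verbatim), jointly period-covariant slices, and the displayed socket `hWloc` («WRAP-UNIFORM» per slice: each
one-periodised slice superposition is bi-localised — gan24-leaf-05's `PeriodicArrayWrapUniform.biLoc_wsum_images`), with `s = n·p`:
`blocksHat p (sortK n (arr s 𝒲^{(s)})) = Σ_{k l : I d n p} (Σ'_m w κ′_k (ŵ_k + s·m))·(Σ'_{m′} w′ κ′_l (ŵ_l + s·m′)) • blocksHat p (sortK n (fun x y a b => Σ'_t arr s (S₂ κ′_k ŵ_k κ′_l (ŵ_l + s·t)) x y a b))`,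
`𝒲^{(s)} := fun x y a b => Σ_{κ′} Σ_{λ′} wsum (w κ′) (u ↦ Σ'_{u″} (Σ'_m w′ λ′ (u″ + s·m)) · S₂ κ′ u λ′ u″) x y a b`, `ŵ_k := windowMap (n·p) (torusBlockEquiv n p (z̄_k, ẑ_k))`. -/
theorem blocksHat_sortK_arr_packed₂_dir (hw : ∀ κ' u, |w κ' u| ≤ C * Real.exp (-δ * l1 (u - P κ')))
    (hw' : ∀ κ' u, |w' κ' u| ≤ C' * Real.exp (-δ * l1 (u - P' κ')))
    (hS₂ : ∀ κ' u κ'' u', BiLoc (S₂ κ' u κ'' u') u u (Ck * Real.exp (-δ * l1 (u' - u))) δ)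
    (hS₂cov : ∀ κ' κ'' u u' m, S₂ κ' (imageShift (n * p) u m) κ'' (imageShift (n * p) u' m) = shiftK (-(((n * p : ℕ) : ℤ) • m)) (S₂ κ' u κ'' u'))
    (hδ : 0 < δ) (hC : 0 ≤ C) (hC' : 0 ≤ C') (hCk : 0 ≤ Ck)
    (hWloc : ∀ κ' κ'', BiLoc (wsum (w κ') (fun u => fun x y a b =>
        ∑' u'' : Fin (d + 1) → ℤ, (∑' m : Fin (d + 1) → ℤ, w' κ'' (imageShift (n * p) u'' m)) * S₂ κ' u κ'' u'' x y a b)) (PW κ' κ'') (QW κ' κ'') CW δW)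
    (hδW : 0 < δW) :
    blocksHat p (sortK n (arr (n * p) (fun x y a b => ∑ κ' : Fin (d + 1), ∑ κ'' : Fin (d + 1),
        wsum (w κ') (fun u => fun x y a b =>
          ∑' u'' : Fin (d + 1) → ℤ, (∑' m : Fin (d + 1) → ℤ, w' κ'' (imageShift (n * p) u'' m)) * S₂ κ' u κ'' u'' x y a b) x y a b)))
      = ∑ k : Beta.Site (d + 1) p × (TorusSite (d + 1) n × Fin (d + 1)), ∑ l : Beta.Site (d + 1) p × (TorusSite (d + 1) n × Fin (d + 1)),
          ((∑' m : Fin (d + 1) → ℤ, w k.2.2 (imageShift (n * p) (windowMap (d + 1) (n * p) (torusBlockEquiv n p (k.1, k.2.1))) m))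
              * (∑' m' : Fin (d + 1) → ℤ, w' l.2.2 (imageShift (n * p) (windowMap (d + 1) (n * p) (torusBlockEquiv n p (l.1, l.2.1))) m')))
            • blocksHat p (sortK n (fun x y a b => ∑' t : Fin (d + 1) → ℤ,
                arr (n * p) (S₂ k.2.2 (windowMap (d + 1) (n * p) (torusBlockEquiv n p (k.1, k.2.1))) l.2.2
                  (imageShift (n * p) (windowMap (d + 1) (n * p) (torusBlockEquiv n p (l.1, l.2.1))) t)) x y a b)) := by
  classical
  -- (i) the `ℤ^D` table is the finite sum of the slice superpositions (product-indexed); its array is the sum of the arrays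
  have harr : arr (n * p) (fun x y a b => ∑ κ' : Fin (d + 1), ∑ κ'' : Fin (d + 1),
        wsum (w κ') (fun u => fun x y a b =>
          ∑' u'' : Fin (d + 1) → ℤ, (∑' m : Fin (d + 1) → ℤ, w' κ'' (imageShift (n * p) u'' m)) * S₂ κ' u κ'' u'' x y a b) x y a b)
      = fun x y a b => ∑ i ∈ (Finset.univ : Finset (Fin (d + 1) × Fin (d + 1))), (1 : ℝ) *
          arr (n * p) (wsum (w i.1) (fun u => fun x y a b =>
            ∑' u'' : Fin (d + 1) → ℤ, (∑' m : Fin (d + 1) → ℤ, w' i.2 (imageShift (n * p) u'' m)) * S₂ i.1 u i.2 u'' x y a b)) x y a b := by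
    funext x y a b
    have e : (fun x y a b => ∑ κ' : Fin (d + 1), ∑ κ'' : Fin (d + 1),
        wsum (w κ') (fun u => fun x y a b =>
          ∑' u'' : Fin (d + 1) → ℤ, (∑' m : Fin (d + 1) → ℤ, w' κ'' (imageShift (n * p) u'' m)) * S₂ κ' u κ'' u'' x y a b) x y a b)
        = fun x y a b => ∑ i ∈ (Finset.univ : Finset (Fin (d + 1) × Fin (d + 1))),
          wsum (w i.1) (fun u => fun x y a b =>
            ∑' u'' : Fin (d + 1) → ℤ, (∑' m : Fin (d + 1) → ℤ, w' i.2 (imageShift (n * p) u'' m)) * S₂ i.1 u i.2 u'' x y a b) x y a b := by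
      funext x y a b; rw [Fintype.sum_prod_type]
    rw [e, arr_finset_sum_apply Finset.univ (fun i _ => hWloc i.1 i.2) hδW (n * p) x y a b]
    simp only [one_mul]
  -- (ii) linearity of `blocksHat p ∘ sortK n` over the slices, §2 per slice, re-indexing
  have hT : ∀ i ∈ (Finset.univ : Finset (Fin (d + 1) × Fin (d + 1))), ∀ (a b : Fib d) (x w₀ : Fin (d + 1) → ℤ),
      Summable fun t => arr (n * p) (wsum (w i.1) (fun u => fun x y a b =>
        ∑' u'' : Fin (d + 1) → ℤ, (∑' m : Fin (d + 1) → ℤ, w' i.2 (imageShift (n * p) u'' m)) * S₂ i.1 u i.2 u'' x y a b))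
          x (imageShift (n * p) w₀ t) a b :=
    fun i _ a b x w₀ => summable_images_arr (hWloc i.1 i.2) hδW (n * p) a b x w₀
  rw [harr, blocksHat_sortK_finset_sum Finset.univ (fun _ => (1 : ℝ)) _ hT]
  simp only [one_smul]
  have hslice : ∀ i : Fin (d + 1) × Fin (d + 1),
      blocksHat p (sortK n (arr (n * p) (wsum (w i.1) (fun u => fun x y a b =>
        ∑' u'' : Fin (d + 1) → ℤ, (∑' m : Fin (d + 1) → ℤ, w' i.2 (imageShift (n * p) u'' m)) * S₂ i.1 u i.2 u'' x y a b))))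
      = ∑ zz : Beta.Site (d + 1) (n * p), ∑ zz' : Beta.Site (d + 1) (n * p),
          ((∑' m : Fin (d + 1) → ℤ, w i.1 (imageShift (n * p) (windowMap (d + 1) (n * p) zz) m))
              * (∑' m' : Fin (d + 1) → ℤ, w' i.2 (imageShift (n * p) (windowMap (d + 1) (n * p) zz') m')))
            • blocksHat p (sortK n (fun x y a b => ∑' t : Fin (d + 1) → ℤ,
                arr (n * p) (S₂ i.1 (windowMap (d + 1) (n * p) zz) i.2 (imageShift (n * p) (windowMap (d + 1) (n * p) zz') t)) x y a b)) :=
    fun i => blocksHat_sortK_arr_packed₂ (n := n) (p := p) (hw i.1) (hw' i.2) (fun u u' => hS₂ i.1 u i.2 u')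
      (fun u u' m => hS₂cov i.1 i.2 u u' m) hδ hC hC' hCk
  simp only [hslice]
  rw [sum_prod_sum_sum (fun κ' (zz : Beta.Site (d + 1) (n * p)) κ'' (zz' : Beta.Site (d + 1) (n * p)) =>
    ((∑' m : Fin (d + 1) → ℤ, w κ' (imageShift (n * p) (windowMap (d + 1) (n * p) zz) m))
        * (∑' m' : Fin (d + 1) → ℤ, w' κ'' (imageShift (n * p) (windowMap (d + 1) (n * p) zz') m')))
      • blocksHat p (sortK n (fun x y a b => ∑' t : Fin (d + 1) → ℤ,
          arr (n * p) (S₂ κ' (windowMap (d + 1) (n * p) zz) κ'' (imageShift (n * p) (windowMap (d + 1) (n * p) zz') t)) x y a b)))]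
  -- re-index `(κ′, zz) ↦ k = (z̄, (ẑ, κ′))` along the equivalence `k ↦ (κ′_k, torusBlockEquiv n p (z̄_k, ẑ_k))`
  obtain ⟨e, he⟩ : ∃ e : Beta.Site (d + 1) p × (TorusSite (d + 1) n × Fin (d + 1)) ≃ Fin (d + 1) × Beta.Site (d + 1) (n * p),
      ∀ k, e k = (k.2.2, torusBlockEquiv n p (k.1, k.2.1)) :=
    ⟨{ toFun := fun k => (k.2.2, torusBlockEquiv n p (k.1, k.2.1)),
       invFun := fun q => (((torusBlockEquiv n p).symm q.2).1, (((torusBlockEquiv n p).symm q.2).2, q.1)),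
       left_inv := fun k => by simp,
       right_inv := fun q => by simp }, fun k => rfl⟩
  rw [sum_sum_reindex e]
  simp only [he]

end Directional

end Summit.QuantumFields.BalabanUV.Beta.D1BFx.PeriodicArrayBiSuperpositionTorus

end
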